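import Literature.MathematicalPhysics.QuantumFieldTheory.Balaban1983to89.B1Ineq225DerivRegularRegion
import Literature.MathematicalPhysics.QuantumFieldTheory.Balaban1983to89.B4Ineq112LpChain

/-!
# `Balaban1983to89.B1Ineq226RegionChain` — [Balaban1982Higgs1] Prop. 2.1 (2.26) p. 610 = [Balaban1983RegularityDecay] Theorem p. 573
# (1.11)–(1.12) FOR A PAIR OF BIG-BLOCK REGIONS `Ω ⊂ Ω₀ ⊂ T_ε` ON THE (Higgs)₂,₃ CARRIER, FROM THE LETTER ESTIMATES: the printed
# cancellation of the two walk expansions (p. 579) — r01's abstract `B4Ineq112LpChain.lp_walk_delta_bound_rem_exp` — instantiated in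
# `Module.End ℝ (T_ε → ℝ^N)` with the projected letters of `B1TorusRegionRop` for `Ω` AND for `Ω₀`, a general probe `Φ`

statement-level skeleton of published theorems with citation tags; proofs where landed; nothing here is a claim about the Yang–Mills mass gap

PDF held: `paper:balaban1982-cmp85-higgs23-i` pp. 610–611 [PDF 8–9]; `paper:balaban1983-cmp89-regularity-decay` pp. 573, 575, 577–579
[PDF 3, 5, 7–9]; p. 579 read on the ×2 render `pub-balaban/b2b-balaban-ref1/pages/1983-cmp89-regularity-decay/…-p009-x2.png`.

CITATION HEADER (lean-in-tree rule).  T. Bałaban, *(Higgs)₂,₃ quantum fields in a finite volume. I. A lower bound*, Commun. Math. Phys.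
**85** (1982) 603–626 [Balaban1982Higgs1] (Prop. 2.1 (2.26) pp. 610–611) and T. Bałaban, *Regularity and decay of lattice Green's functions*,
Commun. Math. Phys. **89** (1983) 571–597 [Balaban1983RegularityDecay] (Theorem p. 573 (1.11)–(1.12); proof p. 579).  Cell `lit-balaban`
(HOME `run/shared/lean/pub/lit-balaban/`), Phase-2 proof seat **p35** gen 13 (unit `lit-balaban-p35`); SKELETON rows **B1.Prop2.1** /
**B1.Eq2.26** (the `δG_k(Ω, Ω₀, A)` clause for REGIONS of `T_ε` on the concrete carrier) and **B4.Thm@573** ((1.11)–(1.12), carrier model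
instance).  USED BY NAME, never restated: r01's `B4Ineq112LpChain.lp_walk_delta_bound_rem_exp` (the abstract cancellation of two walk
expansions through the graded chain, with remainders), `B4RandomWalkDelta112.{Avoids, not_avoids_iff}`, `B4RandomWalk213.{IsWalk, lastPt,
lastPt_succ}`; this lineage's `B1TorusRegionCubes` (pieces, local fields, letters, locality), `B1TorusRegionRop` (projected letters, `GP_eq`,
`exists_tail_le`-type bounds), `B1TorusLabelWalk` (label torus, `tdist_walk_le`, `cube_subset_of_walk`), `B1Ineq225RegionChain` (`nrmT`,
`lpT_two_eq`, `cube_subset_of_near`), `B1TorusCubeLpInput.lpT`, `B1Ineq225DerivRegularRegion.exists_le_of_geometric`.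

WHAT IS PRINTED.  [B1] p. 610–611: *«If Ω ⊂ Ω₀, then for δG_k(Ω, Ω₀, A) defined by the equality δG_k(Ω, Ω₀, A) = G_k(Ω, A) − G_k(Ω₀, A),
(2.26) we have the inequalities (2.24), (2.25) with the additional factor exp(−δ₀ dist(supp f, Ω^c) − δ₀ dist({x, x′}, Ω^c)) on the right
sides.»*  [B4] p. 579: *«To prove the corresponding inequalities for δG_k(Ω, Ω₀, A) = G_k(Ω, A) − G_k(Ω₀, A) with Ω ⊂ Ω₀, we take the
representations (2.13) for both propagators. The terms with ω such that □_{ω_i} are interior cubes of Ω are the same in both representations,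
so they cancel in the difference, and for δG_k we get a representation similar to (2.13) with the additional restriction that at least one
□_{ω_i} intersects the boundary ∂Ω. We estimate the terms of the representation as above and we get the first inequality in (2.22) with
2^{d+1} instead of 2^d and with the restriction n ≥ M⁻¹ sup_{x₁∈Ω^c}(dist({x, x′}, x₁) + dist(x₁, supp f)) − 3
≥ (2M)⁻¹(dist({x, x′}, supp f) + dist({x, x′}, Ω^c) + dist(supp f, Ω^c)) − 3. It implies all the inequalities we need.»*

WHAT THIS FILE PROVES (kernel-checked, zero `sorry`; theorems only, no definition, no `Prop` fact).
* §1 «the terms … are the same in both representations»: for `Ω ⊆ Ω₀` and an interior label `□_j ⊆ Ω` the pieces, local fields, local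
  operators and ALL letters of the two region systems coincide — `piece_eq_of_good_sub`, `fld_eq_of_good_sub`, `Hloc_eq_of_good_sub`,
  `Gloc_eq_of_good_sub`, `aOp_eq_of_good_sub`, `bOp_eq_of_good_sub`, `hTor_smul_chi_smul`/`mulOp_hTor_mul_chi` (`h_j·1_Ω = h_j`), **`aOpP_eq_of_good_sub`**,
  **`bOpP_eq_of_good_sub`**.
* §2 «at least one □_{ω_i} intersects the boundary ∂Ω» ⇒ the length restriction: `tdist_walk_between_le` (centres `s ≤ t` of a walk are
  `≤ 2M(t − s)` apart) and **`sum_tdist_le_of_walk_through`**: for an `n`-step walk on the label torus from a cube seeing `x′` to a cube seeing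
  `y` through a cube containing `z`, `|x′ − y| + |x′ − z| + |z − y| ≤ 8rS + 4M + 4Mn` (the cell's crude form of «(2M)⁻¹(…) − 3»).
* §3 **`chain_region_diff_of_inputs_probe`** — FOR `Ω ⊆ Ω₀` BIG-BLOCK UNIONS, a GENERAL PROBE `Φ` (subadditive, `Φ(0) ≤ 0`,
  `Φ(u − v) ≤ Φ(u) + Φ(v)`, `Φ(w) ≤ 0` when `w` vanishes on the finite probe set `X₀`, `Φ(a_ig) ≤ γ‖g‖_∞` at interior cubes of `Ω`), the LETTER
  ESTIMATES of `B1Ineq225DerivRegularRegion.chain_region_of_inputs_probe` for `Ω` plus the `L²` letter at every piece of `Ω₀`, `R₀` around `X₀`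
  with respect to `Ω`, `f` vanishing within `Dist` of `X₀`, `X₀` at distance `≥ D₀` and `supp f` at distance `≥ D₁` from `Ω^c`, and the joint
  remainder hypothesis: `Φ(G^ε_K(Ω, A)1_Ωf − G^ε_K(Ω₀, A)1_{Ω₀}f) ≤ 4·|X₀|2^d·γ·V·exp(−(Dist + D₀ + D₁ − 8rS − 4M)/(4M))·‖f‖_∞` — the printed
  «2^{d+1} instead of 2^d» and the three-distance exponent.
HONEST SCOPE.  (i) The letter estimates and the remainder decay are HYPOTHESES here (discharged from (2.23) on `Ω₀` in the sequel
`B1Ineq226RegularRegion`).  (ii) The exponent is the cell's crude `(Dist + D₀ + D₁ − 8rS − 4M)/(4M)` (half the rate of this lineage's (2.25)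
files, as the print's `(2M)⁻¹` is half its `M⁻¹`); constants are not optimised.  (iii) `R₀` in the site form `{|y − x′| ≤ 2rS + 2M(n₀+1)} ⊂ Ω`
around every `x′ ∈ X₀`; the print defines `R₀` by (2.19).  (iv) `Ω ⊆ Ω₀` both big-block unions of the same torus `T_ε`; `m² > 0`, `a_K ≥ 0`,
`K ≤ K_P`, `K₀ ∣ M_P`, `K₀ ≥ 8`, `3M ≤ |T_ε|_μ`.  Unit `lit-balaban-p35` gen 13 (literature-prover-lit-balaban-p35-g13-0).
-/

open scoped BigOperators

noncomputable section

namespace Literature.MathematicalPhysics.QuantumFieldTheory.Balaban1983to89.B1Ineq226RegionChain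

open Literature.MathematicalPhysics.QuantumFieldTheory.Balaban1983to89.HiggsLattice
open Literature.MathematicalPhysics.QuantumFieldTheory.Balaban1983to89.HiggsCovariance
open Literature.MathematicalPhysics.QuantumFieldTheory.Balaban1983to89.HiggsCovariancePos
open Literature.MathematicalPhysics.QuantumFieldTheory.Balaban1983to89.HiggsCovarianceCont (sNorm sNorm_nonneg sNorm_sq)
open Literature.MathematicalPhysics.QuantumFieldTheory.Balaban1983to89.B1TorusCubeCover
open Literature.MathematicalPhysics.QuantumFieldTheory.Balaban1983to89.B1TorusCubeLocality26 (rS rS_succ_lt_half cubeVec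
  near_rS_of_hTor_ne_zero mem_cube_of_near_succ)
open Literature.MathematicalPhysics.QuantumFieldTheory.Balaban1983to89.B1TorusCubeChart (dd)
open Literature.MathematicalPhysics.QuantumFieldTheory.Balaban1983to89.B4Lemma22EtaBox (vol vol_pos)
open Literature.MathematicalPhysics.QuantumFieldTheory.Balaban1983to89.B1TorusRegionCubes
open Literature.MathematicalPhysics.QuantumFieldTheory.Balaban1983to89.B1TorusRegionHSizes (IsBigBlockUnion blockSat_of_isBigBlockUnion)
open Literature.MathematicalPhysics.QuantumFieldTheory.Balaban1983to89.B1TorusRegionRop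
open Literature.MathematicalPhysics.QuantumFieldTheory.Balaban1983to89.B1TorusLabelWalk
open Literature.MathematicalPhysics.QuantumFieldTheory.Balaban1983to89.B1TorusCubeLpInput (lpT lpT_def lpT_nonneg)
open Literature.MathematicalPhysics.QuantumFieldTheory.Balaban1983to89.B1Ineq225DecayBackgroundTorus (tdist_le_of_near)
open Literature.MathematicalPhysics.QuantumFieldTheory.Balaban1983to89.B1Ineq234LevelZero (tdist_comm tdist_triangle_real)
open Literature.MathematicalPhysics.QuantumFieldTheory.Balaban1983to89.B1Ineq234Concrete (tdist_self)
open Literature.MathematicalPhysics.QuantumFieldTheory.Balaban1983to89.B1Ineq225RegionChain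
open Literature.MathematicalPhysics.QuantumFieldTheory.Balaban1983to89.B4RandomWalk213 (IsWalk lastPt lastPt_succ)
open Literature.MathematicalPhysics.QuantumFieldTheory.Balaban1983to89.B4RandomWalkDelta112 (Avoids not_avoids_iff)
open Literature.MathematicalPhysics.QuantumFieldTheory.Balaban1983to89.B4Ineq112LpChain (lp_walk_delta_bound_rem_exp)

variable {P : HiggsLattice.Params} {N : ℕ}

/-! ## §1 «The terms with ω such that □_{ω_i} are interior cubes of Ω are the same in both representations» -/

section Agreement

variable (C : ChargeData N) {K K₀ : ℕ} {Ω Ω₀ : Finset (HiggsLattice.Site P 0)} (A : HiggsLattice.VecField P 0) (msq a : ℝ)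

/-- For `Ω ⊆ Ω₀` and an interior cube `□_j ⊆ Ω`, the pieces `Ω ∩ □_j = Ω₀ ∩ □_j = □_j` coincide.
[cite: Balaban1983RegularityDecay, §2 p.575, p.579 «interior cubes of Ω are the same in both representations»] -/
theorem piece_eq_of_good_sub (hsub : Ω ⊆ Ω₀) {j : Lab P K K₀} (hj : cube K K₀ j ⊆ Ω) :
    piece K K₀ Ω j = piece K K₀ Ω₀ j := by
  rw [piece_eq_cube_of_good hj, piece_eq_cube_of_good (hj.trans hsub)]

/-- For `Ω ⊆ Ω₀` and `□_j ⊆ Ω`, the local fields `Ã_j` of the two systems coincide. [cite: Balaban1983RegularityDecay, §2 p.575, p.579] -/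
theorem fld_eq_of_good_sub (hsub : Ω ⊆ Ω₀) {j : Lab P K K₀} (hj : cube K K₀ j ⊆ Ω) :
    fld K K₀ Ω A j = fld K K₀ Ω₀ A j := by
  rw [fld_of_good hj, fld_of_good (hj.trans hsub)]

/-- For `Ω ⊆ Ω₀` and `□_j ⊆ Ω`, the local operators `H_j` coincide. [cite: Balaban1983RegularityDecay, (2.2) p.575, p.579] -/
theorem Hloc_eq_of_good_sub (hsub : Ω ⊆ Ω₀) {j : Lab P K K₀} (hj : cube K K₀ j ⊆ Ω) :
    Hloc C K K₀ Ω A msq a j = Hloc C K K₀ Ω₀ A msq a j := by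
  unfold Hloc
  rw [piece_eq_of_good_sub hsub hj, fld_eq_of_good_sub A hsub hj]

/-- For `Ω ⊆ Ω₀` and `□_j ⊆ Ω`, the local propagators `G_k(□_j, Ã_j)` coincide. [cite: Balaban1983RegularityDecay, (2.2) p.575, p.579] -/
theorem Gloc_eq_of_good_sub (hsub : Ω ⊆ Ω₀) {j : Lab P K K₀} (hj : cube K K₀ j ⊆ Ω) :
    Gloc C K K₀ Ω A msq a j = Gloc C K K₀ Ω₀ A msq a j := by
  unfold Gloc
  rw [piece_eq_of_good_sub hsub hj, fld_eq_of_good_sub A hsub hj]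

/-- For `Ω ⊆ Ω₀` and `□_j ⊆ Ω`, the letters `h_jG_jh_j` of (2.2) coincide. [cite: Balaban1983RegularityDecay, (2.2) p.575, p.579] -/
theorem aOp_eq_of_good_sub (hsub : Ω ⊆ Ω₀) {j : Lab P K K₀} (hj : cube K K₀ j ⊆ Ω) :
    aOp C K K₀ Ω A msq a j = aOp C K K₀ Ω₀ A msq a j := by
  unfold aOp
  rw [Gloc_eq_of_good_sub C A msq a hsub hj]

/-- For `Ω ⊆ Ω₀` and `□_j ⊆ Ω`, the letters `K_jG_jh_j` of (2.11) coincide. [cite: Balaban1983RegularityDecay, (2.11) p.576, p.579] -/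
theorem bOp_eq_of_good_sub (hsub : Ω ⊆ Ω₀) {j : Lab P K K₀} (hj : cube K K₀ j ⊆ Ω) :
    bOp C K K₀ Ω A msq a j = bOp C K K₀ Ω₀ A msq a j := by
  unfold bOp commOp
  rw [Gloc_eq_of_good_sub C A msq a hsub hj, Hloc_eq_of_good_sub C A msq a hsub hj]

/-- `h_j·(1_Ωψ) = h_j·ψ` for an interior cube `□_j ⊆ Ω` (`supp h_j ⊂ {|x − Mj| ≤ rS} ⊂ □_j`; `K ≤ K_P`, `K₀ ∣ M_P`, `K₀ ≥ 8`).
[cite: Balaban1983RegularityDecay, §2 p.575] -/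
theorem hTor_smul_chi_smul (hK : K ≤ P.K) (hK₀ : K₀ ∣ P.M) (hK₀8 : 8 ≤ K₀) {j : Lab P K K₀} (hj : cube K K₀ j ⊆ Ω)
    (ψ : HiggsLattice.ScalarField P 0 N) : hTor K K₀ j • (chi Ω • ψ) = hTor K K₀ j • ψ := by
  funext x
  rw [Pi.smul_apply', chi_smul_apply, Pi.smul_apply']
  split_ifs with hx
  · rfl
  · have h0 : hTor K K₀ j x = 0 := by
      by_contra hne
      exact hx (hj (mem_cube_of_near_succ hK₀8 (near_mono (Nat.le_succ _) (near_rS_of_hTor_ne_zero hK hK₀ hK₀8 hne))))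
    rw [h0, zero_smul, zero_smul]

/-- **`h_j·1_Ω = h_j` FOR AN INTERIOR CUBE** in `Module.End`. [cite: Balaban1983RegularityDecay, §2 p.575] -/
theorem mulOp_hTor_mul_chi (hK : K ≤ P.K) (hK₀ : K₀ ∣ P.M) (hK₀8 : 8 ≤ K₀) {j : Lab P K K₀} (hj : cube K K₀ j ⊆ Ω) :
    mulOp (N := N) (hTor K K₀ j) * mulOp (N := N) (chi Ω) = mulOp (N := N) (hTor K K₀ j) := by
  apply LinearMap.ext
  intro ψ
  rw [Module.End.mul_apply, mulOp_apply, mulOp_apply, mulOp_apply]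
  exact hTor_smul_chi_smul hK hK₀ hK₀8 hj ψ

/-- **THE PROJECTED LETTERS `a_j1_Ω` AND `a_j1_{Ω₀}` COINCIDE AT AN INTERIOR CUBE OF `Ω ⊆ Ω₀`** («the same in both representations»).
[cite: Balaban1983RegularityDecay, p.579, (2.2) p.575] -/
theorem aOpP_eq_of_good_sub (hK : K ≤ P.K) (hK₀ : K₀ ∣ P.M) (hK₀8 : 8 ≤ K₀) (hsub : Ω ⊆ Ω₀) {j : Lab P K K₀}
    (hj : cube K K₀ j ⊆ Ω) : aOpP C K K₀ Ω A msq a j = aOpP C K K₀ Ω₀ A msq a j := by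
  unfold aOpP aOp
  rw [Gloc_eq_of_good_sub C A msq a hsub hj, mul_assoc, mulOp_hTor_mul_chi hK hK₀ hK₀8 hj, mul_assoc (mulOp (N := N) (hTor K K₀ j) * _),
    mulOp_hTor_mul_chi hK hK₀ hK₀8 (hj.trans hsub)]

/-- **THE PROJECTED LETTERS `b_j1_Ω` AND `b_j1_{Ω₀}` COINCIDE AT AN INTERIOR CUBE OF `Ω ⊆ Ω₀`** («the same in both representations»).
[cite: Balaban1983RegularityDecay, p.579, (2.11) p.576] -/
theorem bOpP_eq_of_good_sub (hK : K ≤ P.K) (hK₀ : K₀ ∣ P.M) (hK₀8 : 8 ≤ K₀) (hsub : Ω ⊆ Ω₀) {j : Lab P K K₀}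
    (hj : cube K K₀ j ⊆ Ω) : bOpP C K K₀ Ω A msq a j = bOpP C K K₀ Ω₀ A msq a j := by
  apply LinearMap.ext
  intro ψ
  rw [bOpP_apply, bOpP_apply, bOp_eq_of_good_sub C A msq a hsub hj, bOp_apply, bOp_apply, hTor_smul_chi_smul hK hK₀ hK₀8 hj,
    hTor_smul_chi_smul hK hK₀ hK₀8 (hj.trans hsub)]

end Agreement

/-! ## §2 «at least one □_{ω_i} intersects the boundary ∂Ω»: the length restriction on the label torus -/

section Through

variable {K K₀ : ℕ}

/-- The centres of the points `s ≤ t` of a walk on the label torus are at (1.3)-distance `≤ 2M(t − s)`.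
[cite: Balaban1983RegularityDecay, (2.13) p.577, p.579 «n ≥ M⁻¹ sup_{x₁∈Ω^c}(dist({x, x′}, x₁) + dist(x₁, supp f)) − 3»] -/
theorem tdist_walk_between_le (hK : K ≤ P.K) (hK₀ : K₀ ∣ P.M) {n : ℕ} {i : Lab P K K₀} {ys : Fin n → Lab P K K₀}
    (hw : IsWalk (LAdj K K₀) i ys) :
    ∀ (t : ℕ) (ht : t < n) (s : Fin n), (s : ℕ) ≤ t →
      HiggsLattice.Site.tdist (centerSite K K₀ (ys s)) (centerSite K K₀ (ys ⟨t, ht⟩)) ≤ 2 * half P K K₀ * (t - s)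
  | 0, ht, s, hs => by
    have e : s = ⟨0, ht⟩ := Fin.ext (by simpa using hs)
    subst e
    simp [tdist_self]
  | t + 1, ht, s, hs => by
    rcases Nat.eq_or_lt_of_le hs with h | h
    · have e : s = ⟨t + 1, ht⟩ := Fin.ext h
      subst e
      simp [tdist_self]
    · have h1 := tdist_walk_between_le hK hK₀ hw t (Nat.lt_of_succ_lt ht) s (by omega)
      have hadj : LAdj K K₀ (ys ⟨t, Nat.lt_of_succ_lt ht⟩) (ys ⟨t + 1, ht⟩) := hw ⟨t + 1, ht⟩
      have h2 := tdist_centers_le_of_ladj hK hK₀ hadj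
      have h3 : (HiggsLattice.Site.tdist (centerSite K K₀ (ys s)) (centerSite K K₀ (ys ⟨t + 1, ht⟩)) : ℝ)
          ≤ HiggsLattice.Site.tdist (centerSite K K₀ (ys s)) (centerSite K K₀ (ys ⟨t, Nat.lt_of_succ_lt ht⟩))
            + HiggsLattice.Site.tdist (centerSite K K₀ (ys ⟨t, Nat.lt_of_succ_lt ht⟩)) (centerSite K K₀ (ys ⟨t + 1, ht⟩)) :=
        tdist_triangle_real _ _ _
      have h4 : HiggsLattice.Site.tdist (centerSite K K₀ (ys s)) (centerSite K K₀ (ys ⟨t + 1, ht⟩))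
          ≤ HiggsLattice.Site.tdist (centerSite K K₀ (ys s)) (centerSite K K₀ (ys ⟨t, Nat.lt_of_succ_lt ht⟩))
            + HiggsLattice.Site.tdist (centerSite K K₀ (ys ⟨t, Nat.lt_of_succ_lt ht⟩)) (centerSite K K₀ (ys ⟨t + 1, ht⟩)) := by
        exact_mod_cast h3
      have h5 : 2 * half P K K₀ * (t - s) + 2 * half P K K₀ = 2 * half P K K₀ * (t + 1 - s) := by
        have : t + 1 - (s : ℕ) = (t - s) + 1 := by omega
        rw [this]; ring
      calc _ ≤ _ := h4
        _ ≤ 2 * half P K K₀ * (t - s) + 2 * half P K K₀ := add_le_add h1 h2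
        _ = 2 * half P K K₀ * (t + 1 - s) := h5

/-- **THE THREE-DISTANCE LENGTH RESTRICTION**: if an `n`-step walk on the label torus starts at a cube whose `rS`-core contains `x′`, ends at a
cube whose `rS`-core contains `y`, and its `k`-th cube contains `z`, then `|x′ − y| + |x′ − z| + |z − y| ≤ 8rS + 4M + 4Mn` — the cell's form of
«n ≥ M⁻¹ sup_{x₁∈Ω^c}(dist({x, x′}, x₁) + dist(x₁, supp f)) − 3 ≥ (2M)⁻¹(dist({x, x′}, supp f) + dist({x, x′}, Ω^c) + dist(supp f, Ω^c)) − 3».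
[cite: Balaban1983RegularityDecay, p.579] -/
theorem sum_tdist_le_of_walk_through (hK : K ≤ P.K) (hK₀ : K₀ ∣ P.M) {n : ℕ} {i : Lab P K K₀} {ys : Fin n → Lab P K K₀}
    (hw : IsWalk (LAdj K K₀) i ys) {x' y z : HiggsLattice.Site P 0} (hx : Near K K₀ (rS P K K₀) i x')
    (hy : Near K K₀ (rS P K K₀) (lastPt i n ys) y) (k : Fin n) (hz : z ∈ cube K K₀ (ys k)) :
    HiggsLattice.Site.tdist x' y + HiggsLattice.Site.tdist x' z + HiggsLattice.Site.tdist z y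
      ≤ 8 * rS P K K₀ + 4 * half P K K₀ + 4 * half P K K₀ * n := by
  -- `|x′ − y| ≤ 4rS + 2Mn`
  have hxy := tdist_le_of_walk_near hK hK₀ hw hx hy
  -- the prefix: `|x′ − z| ≤ 2rS + 2M(k + 1) + 2M`
  have h1 : HiggsLattice.Site.tdist x' (centerSite K K₀ i) ≤ 2 * rS P K K₀ := tdist_le_of_near hx (near_center _ i)
  have h2 := tdist_walk_le hK hK₀ hw k.1 k.2
  have h3 : HiggsLattice.Site.tdist (centerSite K K₀ (ys k)) z ≤ 2 * half P K K₀ :=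
    tdist_le_of_near (near_center _ _) (near_half_of_mem_cube hz)
  -- the suffix: `|z − y| ≤ 2M + 2M(n − 1 − k) + 2rS`
  obtain ⟨m, rfl⟩ : ∃ m, n = m + 1 := ⟨n - 1, by have := k.2; omega⟩
  have h4 := tdist_walk_between_le hK hK₀ hw m (Nat.lt_succ_self m) k (by have := k.2; omega)
  have hlast : lastPt i (m + 1) ys = ys ⟨m, Nat.lt_succ_self m⟩ := lastPt_succ i m ys
  have h5 : HiggsLattice.Site.tdist (centerSite K K₀ (ys ⟨m, Nat.lt_succ_self m⟩)) y ≤ 2 * rS P K K₀ := by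
    rw [← hlast]; exact tdist_le_of_near (near_center _ _) hy
  have t1 := tdist_triangle_real x' (centerSite K K₀ i) z
  have t2 := tdist_triangle_real (centerSite K K₀ i) (centerSite K K₀ (ys k)) z
  have t3 := tdist_triangle_real z (centerSite K K₀ (ys k)) y
  have t4 := tdist_triangle_real (centerSite K K₀ (ys k)) (centerSite K K₀ (ys ⟨m, Nat.lt_succ_self m⟩)) y
  have hzc : HiggsLattice.Site.tdist z (centerSite K K₀ (ys k)) ≤ 2 * half P K K₀ := by rw [tdist_comm]; exact h3
  have h : (HiggsLattice.Site.tdist x' y : ℝ) + HiggsLattice.Site.tdist x' z + HiggsLattice.Site.tdist z y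
      ≤ 8 * rS P K K₀ + 4 * half P K K₀ + 4 * half P K K₀ * (m + 1 : ℕ) := by
    have hxy' : (HiggsLattice.Site.tdist x' y : ℝ) ≤ 4 * rS P K K₀ + 2 * half P K K₀ * (m + 1 : ℕ) := by exact_mod_cast hxy
    have h1' : (HiggsLattice.Site.tdist x' (centerSite K K₀ i) : ℝ) ≤ 2 * rS P K K₀ := by exact_mod_cast h1
    have h2' : (HiggsLattice.Site.tdist (centerSite K K₀ i) (centerSite K K₀ (ys ⟨k.1, k.2⟩)) : ℝ) ≤ 2 * half P K K₀ * (k.1 + 1) := by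
      exact_mod_cast h2
    have ek : (ys ⟨k.1, k.2⟩) = ys k := rfl
    rw [ek] at h2'
    have h3' : (HiggsLattice.Site.tdist (centerSite K K₀ (ys k)) z : ℝ) ≤ 2 * half P K K₀ := by exact_mod_cast h3
    have hzc' : (HiggsLattice.Site.tdist z (centerSite K K₀ (ys k)) : ℝ) ≤ 2 * half P K K₀ := by exact_mod_cast hzc
    have h4' : (HiggsLattice.Site.tdist (centerSite K K₀ (ys k)) (centerSite K K₀ (ys ⟨m, Nat.lt_succ_self m⟩)) : ℝ)
        ≤ 2 * half P K K₀ * ((m - k.1 : ℕ) : ℝ) := by exact_mod_cast h4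
    have h5' : (HiggsLattice.Site.tdist (centerSite K K₀ (ys ⟨m, Nat.lt_succ_self m⟩)) y : ℝ) ≤ 2 * rS P K K₀ := by exact_mod_cast h5
    have hmk : ((m - k.1 : ℕ) : ℝ) = (m : ℝ) - k.1 := by
      have := k.2
      rw [Nat.cast_sub (by omega)]
    rw [hmk] at h4'
    have hh : (0 : ℝ) ≤ half P K K₀ := Nat.cast_nonneg _
    push_cast at hxy' ⊢
    nlinarith
  exact_mod_cast h

end Through

/-! ## §3 (2.26)/(1.11)–(1.12) for a pair of big-block regions under `R₀`, general probe, from the letter estimates -/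

section Chain

variable (C : ChargeData N) {K K₀ : ℕ} (Ω Ω₀ : Finset (HiggsLattice.Site P 0)) (A : HiggsLattice.VecField P 0) {msq a : ℝ}

set_option maxHeartbeats 800000 in
/-- **(2.26) = (1.11)–(1.12) FOR A PAIR OF REGIONS, GENERAL PROBE, FROM THE LETTER ESTIMATES.**  `Ω ⊆ Ω₀ ⊂ T_ε` big-block unions, `K ≤ K_P`,
`K₀ ∣ M_P`, `K₀ ≥ 8`, `3M ≤ |T_ε|_μ`, `m² > 0`, `a_K ≥ 0`; `n₀ ≥ 1`; letter constants `γ, β ≥ 0` with `3^dβ ≤ e^{−1}`; a probe `Φ` with `Φ(0) ≤ 0`,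
`Φ(u + v) ≤ Φ(u) + Φ(v)`, `Φ(u − v) ≤ Φ(u) + Φ(v)`, `Φ(w) ≤ 0` whenever `w` vanishes on the finite set `X₀`, and `Φ(a_ig) ≤ γ‖g‖_∞` at the interior
cubes `□_i ⊆ Ω`; at every INTERIOR cube of `Ω` the sup letter `‖b_jψ‖_∞ ≤ β‖ψ‖_∞` ((2.20)), the graded letters `‖b_jψ‖_{q,η} ≤ β‖ψ‖_{p,η}`
(`1 ≤ p ≤ q`, `1/p − 1/q ≤ 1/(2n₀)`) and `‖b_jψ‖_∞ ≤ β‖ψ‖_{2n₀,η}` ((2.21)); at EVERY piece of `Ω` AND of `Ω₀` the `L²` letter `|b_jψ| ≤ β|ψ|`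
(Lemma 2.1); `R₀`: `{y : |y − x′| ≤ 2rS + 2M(n₀+1)} ⊂ Ω` for `x′ ∈ X₀`; `f` vanishing at the sites within `Dist` of `X₀`, `X₀` at distance `≥ D₀`
from `Ω^c`, `supp f` at distance `≥ D₁` from `Ω^c`, `‖f‖_{2,η} ≤ V‖f‖_∞`, `V ≥ 1`; and the joint remainder `Φ((G1_Ω)(R1_Ω)^m f) +
Φ((G1_{Ω₀})(R1_{Ω₀})^m f) → 0`.  THEN
`Φ(G^ε_K(Ω, A)1_Ωf − G^ε_K(Ω₀, A)1_{Ω₀}f) ≤ 4·(|X₀|·2^d)·γ·V·exp(−(Dist + D₀ + D₁ − 8rS − 4M)/(4M))·‖f‖_∞`.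
The proof is the printed one: r01's `lp_walk_delta_bound_rem_exp` with `T` = the labels whose cube is not inside `Ω` (§1: the two letter
families agree off `T`) and the length restriction of §2 for the walks through `T`.
[cite: Balaban1982Higgs1, Prop. 2.1 (2.26) pp.610–611] [cite: Balaban1983RegularityDecay, Theorem (1.11)–(1.12) p.573, proof p.579] -/
theorem chain_region_diff_of_inputs_probe (hK : K ≤ P.K) (hK₀ : K₀ ∣ P.M) (hK₀8 : 8 ≤ K₀)
    (hN3 : ∀ μ, 3 * half P K K₀ ≤ P.sitesPerDir 0 μ) (hΩ : IsBigBlockUnion K K₀ Ω) (hΩ₀ : IsBigBlockUnion K K₀ Ω₀) (hsub : Ω ⊆ Ω₀)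
    (hmsq : 0 < msq) (hak : 0 ≤ B1.aSeq a P.L K)
    {n₀ : ℕ} (hn₀ : 1 ≤ n₀) {γ β : ℝ} (hγ : 0 ≤ γ) (hβ : 0 ≤ β) (hDβ : (3 : ℝ) ^ P.d * β ≤ Real.exp (-1))
    {Φ : HiggsLattice.ScalarField P 0 N → ℝ} (hΦ0 : Φ 0 ≤ 0) (hΦadd : ∀ u v, Φ (u + v) ≤ Φ u + Φ v)
    (hΦsub : ∀ u v, Φ (u - v) ≤ Φ u + Φ v)
    (X₀ : Finset (HiggsLattice.Site P 0))
    (hΦX : ∀ w : HiggsLattice.ScalarField P 0 N, (∀ x' ∈ X₀, w x' = 0) → Φ w ≤ 0)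
    (hΦa : ∀ i : Lab P K K₀, cube K K₀ i ⊆ Ω → ∀ g : HiggsLattice.ScalarField P 0 N, Φ (aOp C K K₀ Ω A msq a i g) ≤ γ * ‖g‖)
    (h0 : ∀ j : Lab P K K₀, cube K K₀ j ⊆ Ω → ∀ ψ : HiggsLattice.ScalarField P 0 N, ‖bOp C K K₀ Ω A msq a j ψ‖ ≤ β * ‖ψ‖)
    (hgr : ∀ j : Lab P K K₀, cube K K₀ j ⊆ Ω → ∀ p q : ℝ, 1 ≤ p → p ≤ q → p⁻¹ - q⁻¹ ≤ (2 * n₀ : ℝ)⁻¹ →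
      ∀ ψ : HiggsLattice.ScalarField P 0 N, lpT K q (bOp C K K₀ Ω A msq a j ψ) ≤ β * lpT K p ψ)
    (hps : ∀ j : Lab P K K₀, cube K K₀ j ⊆ Ω → ∀ ψ : HiggsLattice.ScalarField P 0 N,
      ‖bOp C K K₀ Ω A msq a j ψ‖ ≤ β * lpT K (2 * n₀) ψ)
    (h2 : ∀ (j : Lab P K K₀) (ψ : HiggsLattice.ScalarField P 0 N), (∀ y, y ∉ Ω → ψ y = 0) →
      sNorm (bOp C K K₀ Ω A msq a j ψ) ≤ β * sNorm ψ)
    (h2' : ∀ (j : Lab P K K₀) (ψ : HiggsLattice.ScalarField P 0 N), (∀ y, y ∉ Ω₀ → ψ y = 0) →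
      sNorm (bOp C K K₀ Ω₀ A msq a j ψ) ≤ β * sNorm ψ)
    (hR : ∀ x' ∈ X₀, ∀ y, HiggsLattice.Site.tdist x' y ≤ 2 * rS P K K₀ + 2 * half P K K₀ * (n₀ + 1) → y ∈ Ω)
    (f : HiggsLattice.ScalarField P 0 N) {Dist D₀ D₁ : ℕ} (hf : ∀ x' ∈ X₀, ∀ y, f y ≠ 0 → Dist ≤ HiggsLattice.Site.tdist x' y)
    (hD₀ : ∀ x' ∈ X₀, ∀ z, z ∉ Ω → D₀ ≤ HiggsLattice.Site.tdist x' z)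
    (hD₁ : ∀ y, f y ≠ 0 → ∀ z, z ∉ Ω → D₁ ≤ HiggsLattice.Site.tdist z y)
    {V : ℝ} (hV : 1 ≤ V) (hfV : lpT K 2 f ≤ V * ‖f‖)
    (hrem : ∀ ε' : ℝ, 0 < ε' → ∃ m : ℕ, Φ ((GP C K Ω A msq a * RopP C K K₀ Ω A msq a ^ m) f)
      + Φ ((GP C K Ω₀ A msq a * RopP C K K₀ Ω₀ A msq a ^ m) f) ≤ ε') :
    Φ (propagatorK C Ω A msq a K (chi Ω • f) - propagatorK C Ω₀ A msq a K (chi Ω₀ • f))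
      ≤ 4 * (X₀.card * 2 ^ P.d) * γ * V
          * Real.exp (-((((Dist + D₀ + D₁ : ℕ) : ℝ) - 8 * rS P K K₀ - 4 * half P K K₀) / (4 * half P K K₀))) * ‖f‖ := by
  classical
  have hK₀' : 1 ≤ K₀ := le_trans (by norm_num) hK₀8
  have hh : 0 < (half P K K₀ : ℝ) := by exact_mod_cast half_pos hK₀'
  have hΩb := blockSat_of_isBigBlockUnion (K₀ := K₀) hK hΩ
  have hΩ₀b := blockSat_of_isBigBlockUnion (K₀ := K₀) hK hΩ₀
  have hn₀0 : n₀ ≠ 0 := by omega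
  have hn₀r : (0 : ℝ) < n₀ := by exact_mod_cast hn₀
  -- the sets `S₀`, `S₁`, `T` and the separation count `N`
  set S₀ : Finset (Lab P K K₀) := Finset.univ.filter fun i => ∃ x' ∈ X₀, Near K K₀ (rS P K K₀) i x' with hS₀
  set S₁ : Finset (Lab P K K₀) := Finset.univ.filter fun l => ∃ y, f y ≠ 0 ∧ Near K K₀ (rS P K K₀) l y with hS₁
  set T : Finset (Lab P K K₀) := Finset.univ.filter fun j => ¬ cube K K₀ j ⊆ Ω with hT
  set Nn : ℕ := ⌈((((Dist + D₀ + D₁ : ℕ) : ℝ) - 8 * rS P K K₀ - 4 * half P K K₀) / (4 * half P K K₀))⌉₊ with hNn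
  have hgoodS₀ : ∀ i ∈ S₀, cube K K₀ i ⊆ Ω := fun i hi => by
    rw [hS₀, Finset.mem_filter] at hi
    obtain ⟨x', hx', hnear⟩ := hi.2
    refine cube_subset_of_near (hR x' hx') ?_ hnear
    nlinarith [Nat.zero_le (half P K K₀)]
  have hnotT : ∀ i, i ∉ T → cube K K₀ i ⊆ Ω := fun i hi => by
    by_contra h
    exact hi (by rw [hT, Finset.mem_filter]; exact ⟨Finset.mem_univ _, h⟩)
  have hS₀card : (S₀.card : ℝ) ≤ X₀.card * 2 ^ P.d := by
    have hsub' : S₀ ⊆ X₀.biUnion fun x' => Finset.univ.filter fun i : Lab P K K₀ => Near K K₀ (rS P K K₀) i x' := by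
      intro i hi
      rw [hS₀, Finset.mem_filter] at hi
      obtain ⟨x', hx', hnear⟩ := hi.2
      rw [Finset.mem_biUnion]
      exact ⟨x', hx', by rw [Finset.mem_filter]; exact ⟨Finset.mem_univ _, hnear⟩⟩
    have h1 := (Finset.card_le_card hsub').trans Finset.card_biUnion_le
    have h2 : ∑ x' ∈ X₀, (Finset.univ.filter fun i : Lab P K K₀ => Near K K₀ (rS P K K₀) i x').card ≤ ∑ _x' ∈ X₀, 2 ^ P.d :=
      Finset.sum_le_sum fun x' _ => card_filter_near_rS_le hK hK₀ hK₀8 x'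
    rw [Finset.sum_const, smul_eq_mul] at h2
    exact_mod_cast h1.trans h2
  -- the agreement of the two letter families off `T`
  have haT : ∀ i, i ∉ T → aOpP C K K₀ Ω A msq a i = aOpP C K K₀ Ω₀ A msq a i :=
    fun i hi => aOpP_eq_of_good_sub C A msq a hK hK₀ hK₀8 hsub (hnotT i hi)
  have hbT : ∀ i, i ∉ T → bOpP C K K₀ Ω A msq a i = bOpP C K K₀ Ω₀ A msq a i :=
    fun i hi => bOpP_eq_of_good_sub C A msq a hK hK₀ hK₀8 hsub (hnotT i hi)
  -- the graded letters of the `Ω`-system in the `nrmT` form (shared by the `Ω₀`-system at interior labels)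
  have hgrΩ : ∀ j : Lab P K K₀, cube K K₀ j ⊆ Ω → ∀ i, 1 ≤ i → i ≤ n₀ → ∀ g : HiggsLattice.ScalarField P 0 N,
      nrmT K n₀ (i - 1) (bOpP C K K₀ Ω A msq a j g) ≤ β * nrmT K n₀ i g := by
    intro j hj i hi1 hin g
    rw [bOpP_apply, nrmT_of_ne_zero n₀ (by omega : i ≠ 0)]
    rcases Nat.lt_or_ge 1 i with hi2 | hi2
    · -- grades `i − 1 ≥ 1`: the (p, q) letter with `1/p − 1/q = 1/(2n₀)`
      rw [nrmT_of_ne_zero n₀ (by omega : i - 1 ≠ 0)]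
      have hir : (1 : ℝ) < i := by exact_mod_cast hi2
      have hi0 : (0 : ℝ) < i := by linarith
      have him : (0 : ℝ) < (i : ℝ) - 1 := by linarith
      have hcast : (((i - 1 : ℕ)) : ℝ) = (i : ℝ) - 1 := by rw [Nat.cast_sub (by omega), Nat.cast_one]
      rw [hcast]
      have hp1 : (1 : ℝ) ≤ 2 * n₀ / i := by
        rw [le_div_iff₀ hi0, one_mul]
        have : (i : ℝ) ≤ n₀ := by exact_mod_cast hin
        linarith
      have hpq : (2 * n₀ / i : ℝ) ≤ 2 * n₀ / ((i : ℝ) - 1) :=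
        div_le_div_of_nonneg_left (by positivity) him (by linarith)
      have hdiff : (2 * n₀ / i : ℝ)⁻¹ - (2 * n₀ / ((i : ℝ) - 1))⁻¹ ≤ (2 * n₀ : ℝ)⁻¹ := by
        rw [inv_div, inv_div]
        have : (i : ℝ) / (2 * n₀) - ((i : ℝ) - 1) / (2 * n₀) = (2 * n₀ : ℝ)⁻¹ := by field_simp; ring
        rw [this]
      exact (hgr j hj _ _ hp1 hpq hdiff (chi Ω • g)).trans
        (mul_le_mul_of_nonneg_left (lpT_chi_smul_le Ω (by positivity) g) hβ)
    · -- grade `0` from grade `1`: the (p₁, ∞) letter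
      have hi1' : i = 1 := by omega
      subst hi1'
      rw [show (1 - 1 : ℕ) = 0 from rfl, nrmT_zero, Nat.cast_one, div_one]
      exact (hps j hj (chi Ω • g)).trans (mul_le_mul_of_nonneg_left (lpT_chi_smul_le Ω (by positivity) g) hβ)
  have h0Ω : ∀ j : Lab P K K₀, cube K K₀ j ⊆ Ω → ∀ g : HiggsLattice.ScalarField P 0 N,
      nrmT K n₀ 0 (bOpP C K K₀ Ω A msq a j g) ≤ β * nrmT K n₀ 0 g := fun j hj g => by
    rw [bOpP_apply, nrmT_zero, nrmT_zero]
    exact (h0 j hj _).trans (mul_le_mul_of_nonneg_left (norm_chi_smul_le Ω g) hβ)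
  -- the `L²` letter at every piece, in the `nrmT` form, for a region `Ω′`
  have h2gen : ∀ (Ω' : Finset (HiggsLattice.Site P 0)),
      (∀ (j : Lab P K K₀) (ψ : HiggsLattice.ScalarField P 0 N), (∀ y, y ∉ Ω' → ψ y = 0) →
        sNorm (bOp C K K₀ Ω' A msq a j ψ) ≤ β * sNorm ψ) →
      ∀ (j : Lab P K K₀) (g : HiggsLattice.ScalarField P 0 N),
        nrmT K n₀ n₀ (bOpP C K K₀ Ω' A msq a j g) ≤ β * nrmT K n₀ n₀ g := by
    intro Ω' h2Ω j g
    rw [bOpP_apply, nrmT_top hn₀0, nrmT_top hn₀0, lpT_two_eq, lpT_two_eq]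
    have hc := cTwo_pos P K
    calc (vol (dd P) (P.L - 1) K)⁻¹ ^ (2 : ℝ)⁻¹ * (Real.sqrt (P.mesh 0 ^ P.d))⁻¹ * sNorm (bOp C K K₀ Ω' A msq a j (chi Ω' • g))
        ≤ (vol (dd P) (P.L - 1) K)⁻¹ ^ (2 : ℝ)⁻¹ * (Real.sqrt (P.mesh 0 ^ P.d))⁻¹ * (β * sNorm (chi Ω' • g)) :=
          mul_le_mul_of_nonneg_left (h2Ω j _ (chi_smul_supported Ω' g)) hc.le
      _ ≤ (vol (dd P) (P.L - 1) K)⁻¹ ^ (2 : ℝ)⁻¹ * (Real.sqrt (P.mesh 0 ^ P.d))⁻¹ * (β * sNorm g) :=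
          mul_le_mul_of_nonneg_left (mul_le_mul_of_nonneg_left (sNorm_chi_smul_le Ω' g) hβ) hc.le
      _ = β * ((vol (dd P) (P.L - 1) K)⁻¹ ^ (2 : ℝ)⁻¹ * (Real.sqrt (P.mesh 0 ^ P.d))⁻¹ * sNorm g) := by ring
  -- the first letters at `S₀` and the probe locality, for a region `Ω′`
  have hS₀gen : ∀ (Ω' : Finset (HiggsLattice.Site P 0)) (i : Lab P K K₀), i ∉ S₀ → ∀ g : HiggsLattice.ScalarField P 0 N,
      Φ (aOpP C K K₀ Ω' A msq a i • g) ≤ 0 := by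
    intro Ω' i hi g
    refine hΦX _ fun x' hx' => ?_
    have hi' : ¬ Near K K₀ (rS P K K₀) i x' := fun h =>
      hi (by rw [hS₀, Finset.mem_filter]; exact ⟨Finset.mem_univ _, x', hx', h⟩)
    show (aOpP C K K₀ Ω' A msq a i g) x' = 0
    rw [aOpP_apply]
    exact aOp_apply_eq_zero_off C Ω' A msq a hK hK₀ hK₀8 i _ hi'
  have hS₁agen : ∀ (Ω' : Finset (HiggsLattice.Site P 0)) (i : Lab P K K₀), i ∉ S₁ → aOpP C K K₀ Ω' A msq a i • f = 0 := by
    intro Ω' i hi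
    show aOpP C K K₀ Ω' A msq a i f = 0
    rw [aOpP_apply]
    refine aOp_apply_eq_zero_of_support C Ω' A msq a hK hK₀ hK₀8 i _ fun z hz hzn => hi ?_
    rw [hS₁, Finset.mem_filter]
    refine ⟨Finset.mem_univ _, z, fun hf0 => hz ?_, hzn⟩
    rw [chi_smul_apply]; split_ifs <;> simp [hf0]
  have hS₁bgen : ∀ (Ω' : Finset (HiggsLattice.Site P 0)) (i : Lab P K K₀), i ∉ S₁ → bOpP C K K₀ Ω' A msq a i • f = 0 := by
    intro Ω' i hi
    show bOpP C K K₀ Ω' A msq a i f = 0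
    rw [bOpP_apply]
    refine bOp_apply_eq_zero_of_support C Ω' A msq a hK hK₀ hK₀8 i _ fun z hz hzn => hi ?_
    rw [hS₁, Finset.mem_filter]
    refine ⟨Finset.mem_univ _, z, fun hf0 => hz ?_, hzn⟩
    rw [chi_smul_apply]; split_ifs <;> simp [hf0]
  have haΩ : ∀ i ∈ S₀, ∀ g : HiggsLattice.ScalarField P 0 N, Φ (aOpP C K K₀ Ω A msq a i • g) ≤ γ * nrmT K n₀ 0 g := by
    intro i hi g
    show Φ (aOpP C K K₀ Ω A msq a i g) ≤ γ * nrmT K n₀ 0 g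
    rw [aOpP_apply, nrmT_zero]
    exact (hΦa i (hgoodS₀ i hi) _).trans (mul_le_mul_of_nonneg_left (norm_chi_smul_le Ω g) hγ)
  -- the abstract cancellation of the two expansions through the chain
  have hmain := lp_walk_delta_bound_rem_exp (R := Module.End ℝ (HiggsLattice.ScalarField P 0 N)) (E := HiggsLattice.ScalarField P 0 N)
    (LAdj K K₀) (a := aOpP C K K₀ Ω A msq a) (b := bOpP C K K₀ Ω A msq a)
    (a' := aOpP C K K₀ Ω₀ A msq a) (b' := bOpP C K K₀ Ω₀ A msq a)
    (G := GP C K Ω A msq a) (G' := GP C K Ω₀ A msq a) (G₀ := G0P C K K₀ Ω A msq a) (G₀' := G0P C K K₀ Ω₀ A msq a)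
    (Rop := RopP C K K₀ Ω A msq a) (Rop' := RopP C K K₀ Ω₀ A msq a) (f := f)
    (Φ := Φ) (nrm := nrmT K n₀) (good := fun j : Lab P K K₀ => cube K K₀ j ⊆ Ω)
    (S₀ := S₀) (S₁ := S₁) (T := T) (c₁ := γ) (β := β) (r := (Nn : ℝ) + 2) (D := 3 ^ P.d) (N := Nn) (n₀ := n₀) (V := V)
    G0P_eq_sum RopP_eq_sum G0P_eq_sum RopP_eq_sum
    (GP_eq C Ω A hK hK₀ hK₀8 hN3 hΩb hmsq hak) (GP_eq C Ω₀ A hK hK₀ hK₀8 hN3 hΩ₀b hmsq hak)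
    hrem
    (fun i l hil => aOpP_mul_bOpP_eq_zero C Ω A hK hK₀ hK₀8 hN3 hΩb hmsq hak i l fun y hy =>
      hil (ladj_of_near_near hK hK₀ hK₀8 hy.1 hy.2))
    (fun i l hil => bOpP_mul_bOpP_eq_zero C Ω A hK hK₀ hK₀8 hN3 hΩb hmsq hak i l fun y hy =>
      hil (ladj_of_near_near hK hK₀ hK₀8 hy.1 hy.2))
    (fun i l hil => aOpP_mul_bOpP_eq_zero C Ω₀ A hK hK₀ hK₀8 hN3 hΩ₀b hmsq hak i l fun y hy =>
      hil (ladj_of_near_near hK hK₀ hK₀8 hy.1 hy.2))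
    (fun i l hil => bOpP_mul_bOpP_eq_zero C Ω₀ A hK hK₀ hK₀8 hN3 hΩ₀b hmsq hak i l fun y hy =>
      hil (ladj_of_near_near hK hK₀ hK₀8 hy.1 hy.2))
    haT hbT hΦ0 hΦadd hΦsub
    (hS₀gen Ω) (hS₀gen Ω₀) (hS₁agen Ω) (hS₁bgen Ω) (hS₁agen Ω₀) (hS₁bgen Ω₀)
    hγ haΩ
    (fun i hi g => by rw [← haT i (fun h => (Finset.mem_filter.1 h).2 (hgoodS₀ i hi))]; exact haΩ i hi g)
    hβ hgrΩ (h2gen Ω h2) h0Ω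
    (fun j hj i hi1 hin g => by rw [← hbT j (fun h => (Finset.mem_filter.1 h).2 hj)]; exact hgrΩ j hj i hi1 hin g)
    (h2gen Ω₀ h2')
    (fun j hj g => by rw [← hbT j (fun h => (Finset.mem_filter.1 h).2 hj)]; exact h0Ω j hj g)
    hV
    (by rw [nrmT_top hn₀0, nrmT_zero]; exact hfV)
    (by rw [nrmT_zero]; exact norm_nonneg f)
    (fun n i hi ys hw t ht => by
      rw [hS₀, Finset.mem_filter] at hi
      obtain ⟨x', hx', hnear⟩ := hi.2
      refine cube_subset_of_walk hK hK₀ (hR x' hx') hw hnear t ?_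
      have : (t : ℕ) + 2 ≤ n₀ + 1 := by omega
      nlinarith [Nat.zero_le (half P K K₀)])
    (fun j => card_filter_ladj_le hK hK₀ hK₀' j)
    (by rw [Nat.cast_pow, Nat.cast_ofNat]; exact hDβ)
    (fun n i hi ys hw hl hav => by
      rw [hS₀, Finset.mem_filter] at hi
      rw [hS₁, Finset.mem_filter] at hl
      obtain ⟨x', hx', hnear⟩ := hi.2
      obtain ⟨y, hy, hyn⟩ := hl.2
      -- the walk goes through a label whose cube leaves `Ω`
      rcases not_avoids_iff.1 hav with hiT | ⟨k, hk⟩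
      · exact absurd (hgoodS₀ i (by rw [hS₀, Finset.mem_filter]; exact ⟨Finset.mem_univ _, x', hx', hnear⟩))
          (Finset.mem_filter.1 hiT).2
      · obtain ⟨z, hzc, hzΩ⟩ := Finset.not_subset.1 (Finset.mem_filter.1 hk).2
        have hgeo := sum_tdist_le_of_walk_through hK hK₀ hw hnear hyn k hzc
        have h1 := hf x' hx' y hy
        have h2 := hD₀ x' hx' z hzΩ
        have h3 := hD₁ y hy z hzΩ
        rw [hNn]
        refine Nat.ceil_le.2 ?_
        rw [div_le_iff₀ (by positivity)]
        have : (((Dist + D₀ + D₁ : ℕ)) : ℝ) ≤ 8 * rS P K K₀ + 4 * half P K K₀ + 4 * half P K K₀ * n := by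
          exact_mod_cast (show Dist + D₀ + D₁ ≤ _ by omega)
        linarith)
    (by linarith)
  -- read off the bound
  have hΦ : Φ (propagatorK C Ω A msq a K (chi Ω • f) - propagatorK C Ω₀ A msq a K (chi Ω₀ • f))
      = Φ ((GP C K Ω A msq a - GP C K Ω₀ A msq a) • f) := rfl
  rw [hΦ]
  refine hmain.trans ?_
  rw [nrmT_zero]
  have hexp : Real.exp 2 * Real.exp (-((Nn : ℝ) + 2))
      ≤ Real.exp (-((((Dist + D₀ + D₁ : ℕ) : ℝ) - 8 * rS P K K₀ - 4 * half P K K₀) / (4 * half P K K₀))) := by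
    rw [← Real.exp_add]
    refine Real.exp_le_exp.2 ?_
    have := Nat.le_ceil ((((Dist + D₀ + D₁ : ℕ) : ℝ) - 8 * rS P K K₀ - 4 * half P K K₀) / (4 * half P K K₀))
    rw [← hNn] at this
    linarith
  have hVf : 0 ≤ V * ‖f‖ := mul_nonneg (zero_le_one.trans hV) (norm_nonneg f)
  calc 4 * (S₀.card : ℝ) * γ * V * Real.exp 2 * Real.exp (-((Nn : ℝ) + 2)) * ‖f‖
      = (S₀.card : ℝ) * (Real.exp 2 * Real.exp (-((Nn : ℝ) + 2))) * (4 * γ * (V * ‖f‖)) := by ring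
    _ ≤ (X₀.card * 2 ^ P.d)
          * Real.exp (-((((Dist + D₀ + D₁ : ℕ) : ℝ) - 8 * rS P K K₀ - 4 * half P K K₀) / (4 * half P K K₀))) * (4 * γ * (V * ‖f‖)) :=
        mul_le_mul_of_nonneg_right (mul_le_mul hS₀card hexp (by positivity) (by positivity)) (by positivity)
    _ = 4 * (X₀.card * 2 ^ P.d) * γ * V
          * Real.exp (-((((Dist + D₀ + D₁ : ℕ) : ℝ) - 8 * rS P K K₀ - 4 * half P K K₀) / (4 * half P K K₀))) * ‖f‖ := by ring

end Chain

end Literature.MathematicalPhysics.QuantumFieldTheory.Balaban1983to89.B1Ineq226RegionChain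

end
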